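import Literature.Probability.Percolation.ClusterConditionalCovariance
import Literature.Probability.Percolation.FoldingFibres
import HarnessLib

/-!
# The cluster-transplant bound behind the three-point HALVING LEMMA (v) (Sahi programme, prover prim-sahi-p2 gen 43)

Support file (`--supports stmt-CriticalPhenomena-4575`, helper).  No definitions, no named facts, no sorries; standard axioms.
Memo `run/shared/lean/prim/prim-sahi/FROM-prim-sahi-p2-gen43-TRANSPLANT-REDUCTION.md`; `prim-sahi-p2/PROOF-E3.md` §53.

SETTING.  Bernoulli bond percolation `μ = prodBernoulli w` with arbitrary edge weights on a finite vertex type `V`; three vertices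
`s, a, c`; the five cells of the partition of `{s, a, c}` induced by the open clusters:
`T = μ(sac)` (all joined), `p₁ = μ(sa|c) = μ({s↔a} ∖ {s↔c})`, `p₂ = μ(ac|s) = μ({c↔a} ∖ {c↔s})`, `p₃ = μ(sc|a)`, `p₀ = μ(s|a|c)`.
The HALVING LEMMA (v) of the C5-chord line (memo gen 42 §2, census §187) is the inequality `T·p₀ ≤ (1 + p₃)(p₁ + p₂)`, equivalently
`μ(U)μ(D) ≤ 2μ(U ∩ D)` with `U = {a ↔ s} ∪ {a ↔ c}`, `D = {s ↮ c}`; it is the LINEAR quantitative form of Gladkov's three-cluster dichotomy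
(arXiv:2408.08457 Thm 1.3, tree `GladkovThreeClusterDichotomy`): it gives that theorem with `δ = ε²/4` in place of `ε³/4`.  Nothing in this
file asserts (v).

WHAT IS PROVED (all graphs, all weights).  Write `cut_v(ω') = {e : e meets the open cluster of v in ω'}` (`ClusterConditioning.cutSet`).
* `real_pairSep_eq_sum_transplant` — the CLUSTER-TRANSPLANT IDENTITY
  `μ({s↔a} ∖ {s↔c}) = Σ_{ω'} w(ω') · 1{c ↮ s}(ω') · μ{ω : s ↔ a in ω ∖ cut_c(ω')}`
  (condition on the cluster of `c`; outside it the configuration is fresh), proved with Gladkov's hybrid `ω' →_{cut_c} ω`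
  (`ClusterConditioning.hybrid`, product law `sum_condExpV` = Gladkov Lemma 3.1, cluster locality `reachable_hybrid_iff_diff_cutSet`).
* **`threePoint_transplant_bound`** — `T·p₀ ≤ p₁ + p₂ + B`, where the DOUBLY-BLOCKED MASS is
  `B = Σ_{ω'} w(ω') 1_{s|a|c}(ω') · μ{ω ∈ sac : s ↮ a in ω ∖ cut_c(ω') and c ↮ a in ω ∖ cut_s(ω')}`
  (two independent copies `ω ∈ sac`, `ω' ∈ s|a|c`; transplanting the `ω'`-cluster of `c` into `ω` yields `sa|c` unless that cluster separates `a` from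
  `s` in `ω`, transplanting the `ω'`-cluster of `s` yields `ac|s` unless it separates `a` from `c`; `B` is the mass where BOTH are blocked).
* `halving_of_blocked_le` — hence (v) `T·p₀ ≤ (1 + p₃)(p₁ + p₂)` on a given weighted graph as soon as `B ≤ p₃·(p₁ + p₂)` there
  (this LAW-LEVEL hypothesis has 0 violations in every test — exact enumeration on random weighted graphs up to 6 vertices, ratio
  `p₃(p₁+p₂)/B ≥ 4.4`; adversarial infimum ≈ 4.0, approached only as `p₃ → 1` — and is OPEN in general; its FIBRE (p = ½ complementary)
  form `|F| ≤ |X₁⁺|` is FALSE in 2 of the 59 049 two-copy fibres of `K₅` (the `K_{2,3}` fibre: 6 > 4, kit j330195), while the full fibre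
  count `|F| ≤ |X₁⁺| + φ` (φ = targets missed by the transplants) holds there — see the memo §3 / PROOF-E3 (53d)).
[cite: Gladkov2024, Def. 2.3, Lemma 3.1 (the hybrid and its product law), Thm 1.3 (the qualitative dichotomy)];
[cite: VandenbergHaggstromKahn2005, §1 pp. 7–8 (conditioning on the cluster of a vertex: the rest is percolation on the complement)].
-/

noncomputable section

open Classical

namespace Summit.CriticalPhenomena.PercolationContinuityZ3.Theorems

namespace HalvingTransplant

open MeasureTheory Finset
open Literature.Probability.Percolation Literature.Probability.LatticeModels
open Literature.Probability.Percolation.BHK2006 (weight weight_nonneg)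
open Literature.Probability.Percolation.DecisionTree (ind ind_of_mem ind_of_not_mem ind_nonneg)
open Literature.Probability.Percolation.ClusterConditioning

variable {V : Type*} [Fintype V]

/-- **The hybrid reads the pair-separation cell.**  If `c ↮ s` in `ω'`, then the hybrid `ω' →_{cut_c(ω')} ω` (the `ω'`-cluster of `c`
transplanted into `ω`) lies in `{s ↔ a} ∖ {s ↔ c}` iff `s ↔ a` in `ω` with the pairs meeting that cluster deleted; and if `c ↔ s` in `ω'`
it never does. [cite: Gladkov2024, Lemma 3.1; VandenbergHaggstromKahn2005, §1 p. 8] -/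
theorem ind_pairSep_hybrid (s a c : V) (ω' ω : BondConfig V) :
    ind (openConn s a ∩ (openConn s c)ᶜ : Set (BondConfig V)) (hybrid c ω' ω) =
      ind ((openConn c s : Set (BondConfig V))ᶜ) ω' *
        ind {θ : BondConfig V | (openGraph (θ \ cutSet c ω')).Reachable s a} ω := by
  by_cases hcs : (openGraph ω').Reachable c s
  · -- `c ↔ s` in `ω'`: the hybrid keeps the cluster of `c`, so `s ↔ c` there and the cell indicator vanishes
    have h1 : hybrid c ω' ω ∉ (openConn s a ∩ (openConn s c)ᶜ : Set (BondConfig V)) := by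
      intro h
      exact h.2 (((reachable_hybrid_iff' c ω' ω s).2 hcs).symm)
    have h2 : ω' ∉ ((openConn c s : Set (BondConfig V))ᶜ) := fun h => h hcs
    rw [ind_of_not_mem h1, ind_of_not_mem h2, zero_mul]
  · have h2 : ω' ∈ ((openConn c s : Set (BondConfig V))ᶜ) := hcs
    rw [ind_of_mem h2, one_mul]
    have hsc : ¬ (openGraph (hybrid c ω' ω)).Reachable s c := fun h =>
      hcs (((reachable_hybrid_iff' c ω' ω s).1 h.symm))
    have hsa : (openGraph (hybrid c ω' ω)).Reachable s a ↔ (openGraph (ω \ cutSet c ω')).Reachable s a :=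
      reachable_hybrid_iff_diff_cutSet hcs ω a
    by_cases hr : (openGraph (ω \ cutSet c ω')).Reachable s a
    · have hm : hybrid c ω' ω ∈ (openConn s a ∩ (openConn s c)ᶜ : Set (BondConfig V)) := ⟨hsa.2 hr, hsc⟩
      have hm' : ω ∈ {θ : BondConfig V | (openGraph (θ \ cutSet c ω')).Reachable s a} := hr
      rw [ind_of_mem hm, ind_of_mem hm']
    · have hm : hybrid c ω' ω ∉ (openConn s a ∩ (openConn s c)ᶜ : Set (BondConfig V)) := fun h => hr (hsa.1 h.1)
      have hm' : ω ∉ {θ : BondConfig V | (openGraph (θ \ cutSet c ω')).Reachable s a} := hr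
      rw [ind_of_not_mem hm, ind_of_not_mem hm']

/-- **CLUSTER-TRANSPLANT IDENTITY.**  `μ({s↔a} ∖ {s↔c}) = Σ_{ω'} w(ω')·1{c ↮ s}(ω')·μ{ω : s ↔ a in ω ∖ cut_c(ω')}`: conditionally on the open
cluster of `c` (which must miss `s`), the event `{s ↔ a}` is evaluated in fresh percolation off the pairs meeting that cluster.
[cite: Gladkov2024, Lemma 3.1; VandenbergHaggstromKahn2005, §1 pp. 7–8] -/
theorem real_pairSep_eq_sum_transplant (w : Sym2 V → unitInterval) (s a c : V) :
    (prodBernoulli w).real (openConn s a ∩ (openConn s c)ᶜ) =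
      ∑ ω' : BondConfig V, weight (fun e => (w e : ℝ)) ω' *
        (ind ((openConn c s : Set (BondConfig V))ᶜ) ω' *
          (prodBernoulli w).real {θ : BondConfig V | (openGraph (θ \ cutSet c ω')).Reachable s a}) := by
  rw [prodBernoulli_real_eq_sum_weight_ind, ← sum_condExpV (fun e => (w e : ℝ)) c]
  refine Finset.sum_congr rfl fun ω' _ => ?_
  congr 1
  rw [prodBernoulli_real_eq_sum_weight_ind, Finset.mul_sum]
  unfold condExpV
  refine Finset.sum_congr rfl fun ω _ => ?_
  rw [ind_pairSep_hybrid s a c ω' ω]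
  ring

/-- **THE TRANSPLANT BOUND** `T·p₀ ≤ p₁ + p₂ + B` (see the file header): for two independent copies `ω ∈ {sac}` and `ω' ∈ {s|a|c}`,
transplanting the `ω'`-cluster of `c` into `ω` lands in `sa|c` unless that cluster separates `a` from `s` in `ω`, transplanting the
`ω'`-cluster of `s` lands in `ac|s` unless it separates `a` from `c` in `ω`; both transplants preserve the product law (Gladkov's
Lemma 3.1), so only the doubly-blocked mass `B` is unaccounted for. [this work] -/
theorem threePoint_transplant_bound (w : Sym2 V → unitInterval) (s a c : V) :
    (prodBernoulli w).real (openConn s a ∩ openConn s c) *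
        (prodBernoulli w).real ((openConn s a)ᶜ ∩ (openConn s c)ᶜ ∩ (openConn c a)ᶜ) ≤
      (prodBernoulli w).real (openConn s a ∩ (openConn s c)ᶜ) +
        (prodBernoulli w).real (openConn c a ∩ (openConn c s)ᶜ) +
        ∑ ω' : BondConfig V, weight (fun e => (w e : ℝ)) ω' *
          (ind ((openConn s a)ᶜ ∩ (openConn s c)ᶜ ∩ (openConn c a)ᶜ : Set (BondConfig V)) ω' *
            (prodBernoulli w).real (openConn s a ∩ openConn s c ∩
              {θ : BondConfig V | ¬ (openGraph (θ \ cutSet c ω')).Reachable s a} ∩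
              {θ : BondConfig V | ¬ (openGraph (θ \ cutSet s ω')).Reachable c a})) := by
  set μ := prodBernoulli w with hμ
  set J : Set (BondConfig V) := openConn s a ∩ openConn s c with hJ
  set Z0 : Set (BondConfig V) := (openConn s a)ᶜ ∩ (openConn s c)ᶜ ∩ (openConn c a)ᶜ with hZ0
  have hw0 : ∀ e, 0 ≤ (fun e => (w e : ℝ)) e := fun e => (w e).2.1
  have hw1 : ∀ e, (fun e => (w e : ℝ)) e ≤ 1 := fun e => (w e).2.2
  -- the two transplant identities
  have hc := real_pairSep_eq_sum_transplant w s a c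
  have hs := real_pairSep_eq_sum_transplant w c a s
  -- expand `μ(Z0)` as a weighted sum and distribute
  rw [prodBernoulli_real_eq_sum_weight_ind w Z0, Finset.mul_sum, hc, hs, ← Finset.sum_add_distrib, ← Finset.sum_add_distrib]
  refine Finset.sum_le_sum fun ω' _ => ?_
  have hwt : 0 ≤ weight (fun e => (w e : ℝ)) ω' := weight_nonneg hw0 hw1 ω'
  -- pointwise in ω': either ω' ∉ Z0 (term vanishes on the left) or the union bound on `J`
  by_cases hz : ω' ∈ Z0
  · have hzc : ω' ∈ ((openConn c s : Set (BondConfig V))ᶜ) := by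
      intro h; exact hz.1.2 (show ω' ∈ openConn s c from SimpleGraph.Reachable.symm h)
    have hzs : ω' ∈ ((openConn s c : Set (BondConfig V))ᶜ) := hz.1.2
    rw [ind_of_mem hz, ind_of_mem hzc, ind_of_mem hzs]
    set E1 : Set (BondConfig V) := {θ | (openGraph (θ \ cutSet c ω')).Reachable s a} with hE1
    set E2 : Set (BondConfig V) := {θ | (openGraph (θ \ cutSet s ω')).Reachable c a} with hE2
    have hsub : J ⊆ E1 ∪ E2 ∪ (J ∩ {θ : BondConfig V | ¬ (openGraph (θ \ cutSet c ω')).Reachable s a} ∩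
        {θ : BondConfig V | ¬ (openGraph (θ \ cutSet s ω')).Reachable c a}) := by
      intro θ hθ
      by_cases h1 : θ ∈ E1
      · exact Or.inl (Or.inl h1)
      by_cases h2 : θ ∈ E2
      · exact Or.inl (Or.inr h2)
      exact Or.inr ⟨⟨hθ, h1⟩, h2⟩
    have hle : μ.real J ≤ μ.real E1 + μ.real E2 + μ.real (J ∩ {θ : BondConfig V | ¬ (openGraph (θ \ cutSet c ω')).Reachable s a} ∩
        {θ : BondConfig V | ¬ (openGraph (θ \ cutSet s ω')).Reachable c a}) :=
      calc μ.real J ≤ μ.real (E1 ∪ E2 ∪ (J ∩ {θ : BondConfig V | ¬ (openGraph (θ \ cutSet c ω')).Reachable s a} ∩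
              {θ : BondConfig V | ¬ (openGraph (θ \ cutSet s ω')).Reachable c a})) :=
            measureReal_mono hsub
        _ ≤ μ.real (E1 ∪ E2) + μ.real (J ∩ {θ : BondConfig V | ¬ (openGraph (θ \ cutSet c ω')).Reachable s a} ∩
              {θ : BondConfig V | ¬ (openGraph (θ \ cutSet s ω')).Reachable c a}) := measureReal_union_le _ _
        _ ≤ μ.real E1 + μ.real E2 + _ := by gcongr; exact measureReal_union_le _ _
    have key := mul_le_mul_of_nonneg_left hle hwt
    have key2 : weight (fun e => (w e : ℝ)) ω' * (μ.real E1 + μ.real E2 + μ.real (J ∩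
            {θ : BondConfig V | ¬ (openGraph (θ \ cutSet c ω')).Reachable s a} ∩
            {θ : BondConfig V | ¬ (openGraph (θ \ cutSet s ω')).Reachable c a})) =
        weight (fun e => (w e : ℝ)) ω' * μ.real E1 + weight (fun e => (w e : ℝ)) ω' * μ.real E2 +
          weight (fun e => (w e : ℝ)) ω' * μ.real (J ∩
            {θ : BondConfig V | ¬ (openGraph (θ \ cutSet c ω')).Reachable s a} ∩
            {θ : BondConfig V | ¬ (openGraph (θ \ cutSet s ω')).Reachable c a}) := by ring
    have key3 : μ.real J * (weight (fun e => (w e : ℝ)) ω' * 1) = weight (fun e => (w e : ℝ)) ω' * μ.real J := by ring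
    rw [key3]
    linarith [key, key2]
  · rw [ind_of_not_mem hz]
    have h1 : 0 ≤ weight (fun e => (w e : ℝ)) ω' * (ind ((openConn c s : Set (BondConfig V))ᶜ) ω' *
        μ.real {θ : BondConfig V | (openGraph (θ \ cutSet c ω')).Reachable s a}) :=
      mul_nonneg hwt (mul_nonneg (ind_nonneg _ _) measureReal_nonneg)
    have h2 : 0 ≤ weight (fun e => (w e : ℝ)) ω' * (ind ((openConn s c : Set (BondConfig V))ᶜ) ω' *
        μ.real {θ : BondConfig V | (openGraph (θ \ cutSet s ω')).Reachable c a}) :=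
      mul_nonneg hwt (mul_nonneg (ind_nonneg _ _) measureReal_nonneg)
    nlinarith [h1, h2]

/-- **(v) FROM THE DOUBLY-BLOCKED BOUND.**  On a weighted graph where the doubly-blocked mass `B` of `threePoint_transplant_bound` is at most
`p₃·(p₁ + p₂)` (`p₃ = μ(sc|a) = μ({s↔c} ∖ {s↔a})`), the halving lemma (v) holds in the cell form `T·p₀ ≤ (1 + p₃)(p₁ + p₂)`.
(The hypothesis is a law-level statement verified on every weighted graph tested and proved nowhere; its fibre form is false, see the header.) [this work] -/
theorem halving_of_blocked_le (w : Sym2 V → unitInterval) (s a c : V)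
    (hB : ∑ ω' : BondConfig V, weight (fun e => (w e : ℝ)) ω' *
          (ind ((openConn s a)ᶜ ∩ (openConn s c)ᶜ ∩ (openConn c a)ᶜ : Set (BondConfig V)) ω' *
            (prodBernoulli w).real (openConn s a ∩ openConn s c ∩
              {θ : BondConfig V | ¬ (openGraph (θ \ cutSet c ω')).Reachable s a} ∩
              {θ : BondConfig V | ¬ (openGraph (θ \ cutSet s ω')).Reachable c a})) ≤
        (prodBernoulli w).real (openConn s c ∩ (openConn s a)ᶜ) *
          ((prodBernoulli w).real (openConn s a ∩ (openConn s c)ᶜ) + (prodBernoulli w).real (openConn c a ∩ (openConn c s)ᶜ))) :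
    (prodBernoulli w).real (openConn s a ∩ openConn s c) *
        (prodBernoulli w).real ((openConn s a)ᶜ ∩ (openConn s c)ᶜ ∩ (openConn c a)ᶜ) ≤
      (1 + (prodBernoulli w).real (openConn s c ∩ (openConn s a)ᶜ)) *
        ((prodBernoulli w).real (openConn s a ∩ (openConn s c)ᶜ) + (prodBernoulli w).real (openConn c a ∩ (openConn c s)ᶜ)) := by
  have h := threePoint_transplant_bound w s a c
  nlinarith [h, hB]

/-! ### The form `μ(U)·μ(D) ≤ 2·μ(U ∩ D)` of (v) -/

section UD

variable (w : Sym2 V → unitInterval) (s a c : V)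

omit [Fintype V] in
/-- `U ∩ D` splits into the two pair-separation cells: `({s↔a} ∪ {c↔a}) ∩ {s↮c} = ({s↔a} ∖ {s↔c}) ⊔ ({c↔a} ∖ {c↔s})`. [folklore] -/
theorem inter_D_eq_union :
    ((openConn s a ∪ openConn c a) ∩ (openConn s c)ᶜ : Set (BondConfig V)) =
      (openConn s a ∩ (openConn s c)ᶜ) ∪ (openConn c a ∩ (openConn c s)ᶜ) := by
  ext ω
  simp only [Set.mem_inter_iff, Set.mem_union, Set.mem_compl_iff, openConn, Set.mem_setOf_eq]
  constructor
  · rintro ⟨h | h, hsc⟩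
    · exact Or.inl ⟨h, hsc⟩
    · exact Or.inr ⟨h, fun h' => hsc h'.symm⟩
  · rintro (⟨h, hsc⟩ | ⟨h, hcs⟩)
    · exact ⟨Or.inl h, hsc⟩
    · exact ⟨Or.inr h, fun h' => hcs h'.symm⟩

omit [Fintype V] in
/-- The two pair-separation cells are disjoint (`s↔a` and `c↔a` force `s↔c`). [folklore] -/
theorem disjoint_pairSep :
    Disjoint (openConn s a ∩ (openConn s c)ᶜ : Set (BondConfig V)) (openConn c a ∩ (openConn c s)ᶜ) := by
  rw [Set.disjoint_left]
  rintro ω ⟨hsa, hsc⟩ ⟨hca, -⟩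
  exact hsc (hsa.trans hca.symm)

omit [Fintype V] in
/-- `U ∖ D = {sac}`: `({s↔a} ∪ {c↔a}) ∩ {s↔c} = {s↔a} ∩ {s↔c}`. [folklore] -/
theorem inter_Dc_eq_J :
    ((openConn s a ∪ openConn c a) ∩ openConn s c : Set (BondConfig V)) = openConn s a ∩ openConn s c := by
  ext ω
  simp only [Set.mem_inter_iff, Set.mem_union, openConn, Set.mem_setOf_eq]
  constructor
  · rintro ⟨h | h, hsc⟩
    · exact ⟨h, hsc⟩
    · exact ⟨hsc.trans h, hsc⟩
  · rintro ⟨h, hsc⟩; exact ⟨Or.inl h, hsc⟩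

omit [Fintype V] in
/-- `D ∖ U = {s|a|c}`. [folklore] -/
theorem D_diff_U_eq_Z0 :
    ((openConn s c)ᶜ ∩ (openConn s a ∪ openConn c a)ᶜ : Set (BondConfig V)) =
      (openConn s a)ᶜ ∩ (openConn s c)ᶜ ∩ (openConn c a)ᶜ := by
  ext ω
  simp only [Set.mem_inter_iff, Set.mem_union, Set.mem_compl_iff, not_or]
  tauto

omit [Fintype V] in
/-- `{s↔c} = {sac} ⊔ {sc|a}`. [folklore] -/
theorem openConn_eq_J_union_SC :
    (openConn s c : Set (BondConfig V)) = (openConn s a ∩ openConn s c) ∪ (openConn s c ∩ (openConn s a)ᶜ) := by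
  ext ω
  simp only [Set.mem_inter_iff, Set.mem_union, Set.mem_compl_iff]
  tauto

/-- **(v) IN THE FORM `μ(U)·μ(D) ≤ 2·μ(U ∩ D)`** (`U = {a↔s} ∪ {a↔c}`, `D = {s↮c}`: "conditioning on `s ↮ c` at most halves the probability that
`a` is joined to `{s, c}`"), on every weighted graph where the doubly-blocked mass is at most `p₃(p₁+p₂)`.  The passage between the two forms is
the identity `μ(U)μ(D) = μ(U∩D)(μ(D) + μ(sac)) + μ(sac)μ(s|a|c)` together with `1 − μ(D) = μ(sac) + μ(sc|a)`. [this work] -/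
theorem halvingUD_of_blocked_le
    (hB : ∑ ω' : BondConfig V, weight (fun e => (w e : ℝ)) ω' *
          (ind ((openConn s a)ᶜ ∩ (openConn s c)ᶜ ∩ (openConn c a)ᶜ : Set (BondConfig V)) ω' *
            (prodBernoulli w).real (openConn s a ∩ openConn s c ∩
              {θ : BondConfig V | ¬ (openGraph (θ \ cutSet c ω')).Reachable s a} ∩
              {θ : BondConfig V | ¬ (openGraph (θ \ cutSet s ω')).Reachable c a})) ≤
        (prodBernoulli w).real (openConn s c ∩ (openConn s a)ᶜ) *
          ((prodBernoulli w).real (openConn s a ∩ (openConn s c)ᶜ) + (prodBernoulli w).real (openConn c a ∩ (openConn c s)ᶜ))) :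
    (prodBernoulli w).real (openConn s a ∪ openConn c a) * (prodBernoulli w).real ((openConn s c)ᶜ) ≤
      2 * (prodBernoulli w).real ((openConn s a ∪ openConn c a) ∩ (openConn s c)ᶜ) := by
  set μ := prodBernoulli w with hμ
  have hcell := halving_of_blocked_le w s a c hB
  -- the cell decomposition of the four probabilities
  have hX : μ.real ((openConn s a ∪ openConn c a) ∩ (openConn s c)ᶜ) =
      μ.real (openConn s a ∩ (openConn s c)ᶜ) + μ.real (openConn c a ∩ (openConn c s)ᶜ) := by
    rw [inter_D_eq_union, measureReal_union (disjoint_pairSep s a c) MeasurableSet.of_discrete]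
  have hU : μ.real (openConn s a ∪ openConn c a) =
      μ.real ((openConn s a ∪ openConn c a) ∩ (openConn s c)ᶜ) + μ.real (openConn s a ∩ openConn s c) := by
    rw [← inter_Dc_eq_J s a c, ← measureReal_inter_add_sdiff₀ (s := openConn s a ∪ openConn c a) (t := (openConn s c)ᶜ)
      (MeasurableSet.of_discrete).nullMeasurableSet]
    congr 2
    ext ω; simp only [Set.mem_sdiff, Set.mem_compl_iff, not_not, Set.mem_inter_iff]
  have hD : μ.real ((openConn s c)ᶜ) =
      μ.real ((openConn s a ∪ openConn c a) ∩ (openConn s c)ᶜ) + μ.real ((openConn s a)ᶜ ∩ (openConn s c)ᶜ ∩ (openConn c a)ᶜ) := by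
    rw [← D_diff_U_eq_Z0 s a c, Set.inter_comm (openConn s a ∪ openConn c a),
      ← measureReal_inter_add_sdiff₀ (s := (openConn s c)ᶜ) (t := openConn s a ∪ openConn c a)
      (MeasurableSet.of_discrete).nullMeasurableSet]
    congr 2
  have hDc : μ.real ((openConn s c)ᶜ) = 1 - (μ.real (openConn s a ∩ openConn s c) + μ.real (openConn s c ∩ (openConn s a)ᶜ)) := by
    rw [measureReal_compl MeasurableSet.of_discrete, probReal_univ]
    congr 1
    conv_lhs => rw [openConn_eq_J_union_SC s a c]
    rw [measureReal_union _ MeasurableSet.of_discrete]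
    rw [Set.disjoint_left]
    rintro ω ⟨hsa, -⟩ ⟨-, hna⟩
    exact hna hsa
  -- algebra
  set X := μ.real ((openConn s a ∪ openConn c a) ∩ (openConn s c)ᶜ)
  set T := μ.real (openConn s a ∩ openConn s c)
  set P0 := μ.real ((openConn s a)ᶜ ∩ (openConn s c)ᶜ ∩ (openConn c a)ᶜ)
  set P3 := μ.real (openConn s c ∩ (openConn s a)ᶜ)
  have hX0 : 0 ≤ X := measureReal_nonneg
  rw [hU, hD]
  rw [← hX] at hcell
  have hD' : X + P0 = 1 - (T + P3) := by rw [← hD, hDc]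
  have key : (X + T) * (X + P0) = X * (X + P0 + T) + T * P0 := by ring
  rw [key, hD']
  nlinarith [hcell, hX0]

end UD

end HalvingTransplant

end Summit.CriticalPhenomena.PercolationContinuityZ3.Theorems

end
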